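import Summits.QuantumFields.YangMills.Theses.UnitScaleTilt
import Literature.MathematicalPhysics.QuantumFieldTheory.Balaban1983to89.T3SplitLog
import Literature.MathematicalPhysics.QuantumFieldTheory.Balaban1983to89.T3UpperLiftSplitLog
import Literature.MathematicalPhysics.QuantumFieldTheory.Balaban1983to89.T3ExistSplit
import Summits.QuantumFields.YangMills.Theorems.UnitScaleTiltMinimiserStabilityRegPrAvgActionDefect
import Summits.QuantumFields.YangMills.Theorems.UnitScaleTiltMinimiserStabilityRegPrAvgCurvGrad
import Summits.QuantumFields.YangMills.Theorems.UnitScaleTiltMinimiserStabilityRegPrAttainmentOfLeaves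
import Summits.QuantumFields.YangMills.Theorems.UnitScaleTiltMinimiserStabilityRegPrSmoothLift
import Summits.QuantumFields.YangMills.Theorems.UnitScaleTiltMinimiserStabilityRegPrCritCurvGradLog
import Summits.QuantumFields.YangMills.Theorems.UnitScaleTiltMinimiserStabilityRegPrProp8Iter
import Summits.QuantumFields.YangMills.Theorems.UnitScaleTiltProp7PV3CDEAtSPrint
import Summits.QuantumFields.YangMills.Theorems.UnitScaleTiltProp7PV3CUniqueness
import HarnessLib

/-!
# LAYER-4 BIRTH v9 of the K1 crux child «MinimiserStabilityRegPr» (stmt-QuantumFields-19200) = registered v8 (5b4e846794b80374) WITH THE V3 ROWS RE-CUT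
# {A, C, D, E} → {A, C-uniq, EX} (OWNER RULING g24-№3′, HOME route-R3/ym/plan-g24/OWNER-RULING-g24-3prime.md; w2-19200 LOCATED FINDINGS #2–#3)
# — penned by the route owner (ym3-torus-plan g24); registration by OPS on R-request C4b only; stubs {stub_halvingStep, stub_PV3A, stub_PV3Cuniq, stub_existenceMinimalOrbit}.
#
# v9 CHANGE (numbers, not adjectives).  V3 = [Balaban1985Variational] Prop. 7 from a background (14) = clause (i) «at most one critical orbit in (6)(ε₀),
# B₃ε₁ ≤ ε₀ ≤ a₀» ∧ clause (ii) «a minimal orbit in (6)(O₁L³B₃ε₁), ε₁ ≤ a′₁».  v8 displayed V3 ⇐ A ∧ C ∧ D ∧ E (print's p.296∕p.299 assembly).  Two located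
# findings of the W-seat on rows C∕D∕E (w2-19200 g0, 2026-08-28): #2 — the registered row E quantified ε₁ free (no (7)-hypothesis, no window), an unproved
# strengthening of (141)–(142); #3 — at the carrier's reading R2 (`IsCritR2` := minimiser over SOME regular fibre (6)(e′)) the ∃-half of row C («∃ X … e^{iX}U₀
# critical») already IS attainment in chart coordinates, which in print is the END of the route (Prop. 6's contraction gives a solution of (111); minimality only
# after (142) + [Balaban1985RegularSpaces] Thm 2's covering), while the p.296 argument (122) for clause (i) uses ONLY C's uniqueness half.  Hence v9:
#   A       `stub_PV3A`   — [Balaban1985RegularSpaces] THEOREM 2 for the based letters (v8 VERBATIM; supplier WANTED W-19200-T2 = lit-balaban G-B8-T2S M1–M4 +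
#                           G-B9-LETTERS, entering as the by-name socket `stub_PV3A_of_lettersAt`);
#   C-uniq  `stub_PV3Cuniq` — the UNIQUENESS HALF of [Balaban1985Variational] Prop. 6 at the based letters: two `𝔤`-valued `X, X′` in the (19)-ball `ε₄` with
#                           (20), (21) making `e^{iX}U₀` L-critical coincide (= hypothesis `hCuniq` of `Prop7PV3CUniqueness.prop7From14At_v8_of_A_Cuniq_att`
#                           VERBATIM; implied by v8's row C, `uniq_of_stub_PV3C_text`);
#   EX      `stub_existenceMinimalOrbit` — Prop. 7's EXISTENCE CLAUSE from a background, reading R1, member-uniform — DISPLAYED AS ITSELF (text shared VERBATIM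
#                           with line «route-R»'s `RouteR.stub_existenceMinimalOrbit`, pen 3f491a7acec57804: one landing credits both lines).  Print's internal
#                           route to it (Props 5–6 ∃ → (141)–(142) → Thm 2 covering) passes through E–L-criticality, which the carrier does not type; attack routes
#                           (α) chart route after an `IsCritEL` notion, (β) direct method on the CLOSED fibre + KKT-halving interiority (unprinted) — card §3.
# Clause (i) ⇐ A ∧ C-uniq is `Prop7PV3CUniqueness.atMostOneCriticalOrbit_of_A_Cuniq` (p590201) at `sPrint L T₀` + `T3SectALandauChart.sat14T3_of_mem_fibre`;
# clause (ii) = EX verbatim.  Rows D (LANDED p589019, `Theorems.PV3D.stub_PV3D`) and E′ (RULING g24-№3's regimed text; documentary) LEAVE the skeleton — both are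
# steps of print's internal route to EX and are consumed by no v9 composition.  Everything else (halving stub, `landed_prop8`, V4′, `variational_of_leaves_log`,
# `MinimiserStabilityRegPr_of`) is v8 VERBATIM.  Docstring page slips of v8 fixed (lit g22 t6: Props 5–6 pp.294–295; (18)–(19) pp.280–281; [B8] Thm 2 p.83).
# (v8∕v7 headers kept below for the record.)
# was (v8): V3 `stub_prop7From14` REPLACED BY THE FOUR NATIVE PRINT ROWS P-V3-A ∕ C ∕ D ∕ E (OWNER RULING g24-№1 §A + A2′); composition
# `Prop7PV3CDEAtSPrint.prop7From14At_v8` at `S_v8 := tPrintFam (sPrint L T)`; regime token `L³B₃ε₁ ≤ ε₂` of D mandatory (unregimed `axial18` refutable by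
# `U₁ = 1, X = 0`, `T3SectALandauChart.in19_one_zero` + `regPr_gaugeAct_iff`).
# (v7 header kept below for the record.)
# was: LAYER-4 BIRTH v7 CANDIDATE … = registered v6 (636b1fa3b005b89b) WITH STUB V2 `stub_prop8` REPLACED BY THE ONE-STEP HALVING STUB `stub_halvingStep`
# (OWNER RULING g20-№2 (B)) and V4′ `stub_critCurvGradLog` LANDED (p511133).

WHY V4′ (HOME/UV3-NODE.md §21; evidence #36 on 19200): v5's V4 = `B11.SectFPrinted B₃ (famX L)` is EXACTLY the `β = β₀ = 1` clause of [Balaban1985Variational] (9)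
for critical configurations — print does not derive it ([Balaban1985RegularSpaces] Thm 2 (1.36) is `β₀ < 1`) and for the constrained minimiser it fails like
`(K − n)·log L`; every use tolerates a factor polynomial in `K − n` (`ε₁ = B₃·θBal(⌊K/m⌋)` decays geometrically), so V4′ is the log-Lipschitz statement
`CritCurvGradLogAt` (LANDED, p511133) and the compositions are the re-derived ones of `T3CurvGradLog` ∕ `T3SplitLog` ∕ `T3UpperLiftSplitLog`.

Stubs (sorries ONLY here) — v9: `stub_halvingStep` (V2′, verbatim v7∕v8), `stub_PV3A` (verbatim v8), `stub_PV3Cuniq`, `stub_existenceMinimalOrbit` (V3 rows).  Theorems with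
no sorry of their own: `landed_prop8` (V2 ⇐ V2′, `Prop8Iter`), `prop7From14_v9` (V3 ⇐ A ∧ C-uniq ∧ EX, `Prop7PV3CUniqueness`), `stub_critCurvGradLog` (V4′, p511133), `landed_smoothLift` (p466834),
`landed_avgCurvGrad` (p440643), `landed_avgActionDefect` (p437535), `variational_of_leaves_log`, and the composition `MinimiserStabilityRegPr_of`, which concludes
the route decl BY NAME.
-/

noncomputable section

open MeasureTheory Filter Topology
open scoped Matrix.Norms.L2Operator
open Literature.MathematicalPhysics.QuantumFieldTheory.Balaban1983to89
open Literature.MathematicalPhysics.QuantumFieldTheory.Balaban1983to89.T3ContinuumYM3Torus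
open Literature.MathematicalPhysics.QuantumFieldTheory.Balaban1983to89.T3UnitLawDensityEML (ℰp measurableE_ℰp)
open Literature.MathematicalPhysics.QuantumFieldTheory.Balaban1983to89.T3UnitScaleTilt
open Literature.MathematicalPhysics.QuantumFieldTheory.Balaban1983to89.T3TiltDescent
open Literature.MathematicalPhysics.QuantumFieldTheory.Balaban1983to89.T3CruxEstimates
open Literature.MathematicalPhysics.QuantumFieldTheory.Balaban1983to89.T3ConstrainedMinimiser
open Literature.MathematicalPhysics.QuantumFieldTheory.Balaban1983to89.T3DescentFibreTower
open Literature.MathematicalPhysics.QuantumFieldTheory.Balaban1983to89.T3MinimiserStabilityReduction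
open Literature.MathematicalPhysics.QuantumFieldTheory.Balaban1983to89.T3RegularMinimiser
open Literature.MathematicalPhysics.QuantumFieldTheory.Balaban1983to89.T3PrintedRegularMinimiser
open Literature.MathematicalPhysics.QuantumFieldTheory.Balaban1983to89.T3PrintedRegularMinimiserReduction
open Literature.MathematicalPhysics.QuantumFieldTheory.Balaban1983to89.T3PrintedMinimiserExistence
open Literature.MathematicalPhysics.QuantumFieldTheory.Balaban1983to89.T3LowerAlongMinimisersSplit
open Literature.MathematicalPhysics.QuantumFieldTheory.Balaban1983to89.T3AvgDivergenceSplit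
open Literature.MathematicalPhysics.QuantumFieldTheory.Balaban1983to89.T3UpperAlongMinimisersSplit
open Literature.MathematicalPhysics.QuantumFieldTheory.Balaban1983to89.T3UpperLiftSplit
open Literature.MathematicalPhysics.QuantumFieldTheory.Balaban1983to89.T3LowerActionSplit
open Literature.MathematicalPhysics.QuantumFieldTheory.Balaban1983to89.T3ExistSplit
open Literature.MathematicalPhysics.QuantumFieldTheory.Balaban1983to89.T3Thm1Carrier
open Literature.MathematicalPhysics.QuantumFieldTheory.Balaban1983to89.T3CurvGradLog
open Literature.MathematicalPhysics.QuantumFieldTheory.Balaban1983to89.T3SplitLog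
open Literature.MathematicalPhysics.QuantumFieldTheory.Balaban1983to89.T3UpperLiftSplitLog
open Literature.MathematicalPhysics.QuantumFieldTheory.Balaban1983to89.B11 (Prop8Printed)
open Literature.MathematicalPhysics.QuantumFieldTheory.Balaban1983to89.T3Thm1CarrierNative (IsCritR2 Prop7From14At)
open Literature.MathematicalPhysics.QuantumFieldTheory.Balaban1983to89.T3SectALandauChart (ResidFam famLG3 In19 CloseAvg emb15 bridgeFam3 sat14T3_of_mem_fibre)
open Literature.MathematicalPhysics.QuantumFieldTheory.Balaban1983to89.B11 (Prop2Printed Prop6Printed)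
open Summit.QuantumFields.YangMills.Theorems.Prop7TPrint (tPrintFam nMax19 expHermField)
open Summit.QuantumFields.YangMills.Theorems.Prop7SPrint (sPrint IsAxialPrint RestrictedPrint AvgCondPrint IsLandauPrint CritLPrint hSax_sPrint hSre_sPrint)

namespace Summit.QuantumFields.YangMills.Cruxes.MinimiserStabilityRegPr.BirthV9

/-! ## §1 Registered stubs (each a genuine lemma of the line; sorries live ONLY here) -/

/-- STUB V2′ — THE ONE-STEP HALVING of [Balaban1985Variational] Sect. F at the d = 3 carriers (p. 304, verbatim: «hence U_k belongs to the space (2) with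
max{B₃ε₁, ½ε₀} instead of ε₀»; Sect. F p. 300: «We will use only the fact that they are critical configurations of the functional (5) and that they belong to the
spaces (6) with ε₀ sufficiently small»), for SOME B₃ > 4 and a₅ > 0: `Prop8Printed`'s binders with the conclusion HALVED — for every member `i` (block size `L`,
heights `n < K`), `0 < ε₁`, every (7)-datum `V`, every `U ∈ 𝔘_k(ε₀) ∩ 𝔅_k(V)` critical in reading R2, `ε₀ ≤ a₅` ⇒ `U ∈ 𝔘_k(max{B₃ε₁, ½ε₀})` (OWNER RULING g20-№2 (B1)).
Equivalent readings (p1 g14 `Prop8Iter.halvingLiteral_iff_halvingStep` / `…_iff_native`): `∀ i, B11Prop8Assembly.HalvingStep (famX L i) B₃ a₅`,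
`T3Thm1CarrierNative.HalvingNativeAt L a₅ B₃`; reducible to MINIMISERS over (6)(ε₀), `0 < ε₀ ≤ a₅` (`Prop8Iter.halvingLiteral_of_minimisers`).
Content (work map, owner (B3)): [Balaban1985RegularSpaces] Thm 2 gauge (152), the flat constrained propagators of [Balaban1984PropagatorsII] (2.47)–(2.51) (162)–(164),
the datum bound (160), smallness (165)–(168). XL. [cite: Balaban1985Variational, Sect. F p.304 before Prop. 8] -/
theorem stub_halvingStep : ∀ (L : ℕ), 1 < L → ∃ B₃ : ℝ, 4 < B₃ ∧ ∃ a₅ : ℝ, 0 < a₅ ∧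
    ∀ (i : Idx L) (ε₀ ε₁ : ℝ), 0 < ε₁ → ∀ (V : (famX L i).Bdry) (U : (famX L i).Cfg), (famX L i).Reg7 ε₁ V → (famX L i).InU ε₀ U →
      (famX L i).InB V U → (famX L i).IsCritical V U → ε₀ ≤ a₅ → (famX L i).InU (max (B₃ * ε₁) (ε₀ / 2)) U := by
  sorry

/-- STUB P-V3-A — [Balaban1985RegularSpaces] THEOREM 2 (the chart of `𝔅_k(V) ∩ Ax_k(U₀)` by the small fields of (19)–(21), «we can take β₀, α₁ arbitrary
positive numbers and then there exists B₁ such that the above theorem holds» p. 83) READ AS [Balaban1985Variational] PROP. 2 at the T³ carriers of block size `L`,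
for PRINT'S BASED LETTERS (w1 `Prop7SPrint.sPrint`: (1.19) `IsAxialPrint`, (1.29) `RestrictedPrint`, (20) `AvgCondPrint`, (21) `IsLandauPrint`, `CritLPrint`; the
Sect. C–E tail `T` is NOT read by Prop. 2: `Prop2Printed … (famLG3 L (tPrintFam A)) ↔ Prop2Printed … (famLG3 L A)` is `Iff.rfl`, w2 `Prop7PV3CDEAtSPrint.prop2Printed_tPrintFam_iff`):
for every B₃ > 4 SOME `B₁, c₁ > 0` with `B11.Prop2Printed B₁ B₃ L³ c₁ (famLG3 L (sPrint L T))` — w1's A1 text VERBATIM (OWNER RULING g24-№1 §A).  Native unfolding: `T3SectALandauChart.prop2Printed_famLG3_iff_native`.  Content: [6] Thm 2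
on `ℤᵈ` (typed: `B8Thm2TorusAt`, `B8Eq131Derivation`) transported to the torus through the based periodic pullback (`B10Eq27TorusAxialLog.pull`); injectivity of
(16) is LANDED (`Prop7AxialReprPrint.inj16_print_based`). L∕XL. Why it might fail: only by a letter mismatch between the based torus readings and [6]'s `ℤᵈ`
statement (the `u`-free form (1.31) vs the defining form (1.28)–(1.30) of (20)). [cite: Balaban1985RegularSpaces, Thm 2 p.83, (1.28)-(1.31) pp.81-82;
Balaban1985Variational, Prop. 2 p.281] -/
theorem stub_PV3A : ∀ (L : ℕ), 1 < L → ∀ (T : ResidFam L) (B₃ : ℝ), 4 < B₃ →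
    ∃ B₁ c₁ : ℝ, 0 < B₁ ∧ 0 < c₁ ∧ Prop2Printed B₁ B₃ ((L : ℝ) ^ 3) c₁ (famLG3 L (sPrint L T)) := by
  sorry

/-- ROW (C-uniq) — THE UNIQUENESS HALF OF [Balaban1985Variational] PROP. 6 at print's based T³ letters (RULING g24-№3′; w2-19200 LOCATED FINDING #3):
for every `L > 1`, `B₃ > 4` SOME `B₀, a₄ > 0` such that at every member, every (14)-background `U₀` and every (7)-type datum, TWO `𝔤`-valued fields `X, X′` in the
(19)-ball `ε₄` (`2B₀L³B₃ε₁ ≤ ε₄ ≤ a₄`) which satisfy (20) (average condition), (21) (Landau gauge) and make `e^{iX}U₀` L-critical COINCIDE.  = hypothesis `hCuniq` of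
`Prop7PV3CUniqueness.prop7From14At_v8_of_A_Cuniq_att` VERBATIM (∀-closed over `L, B₃`); implied by the v8 row (C) (`uniq_of_stub_PV3C_text`).  The ∃-half of v8's
(C) is NOT re-registered: at the carrier's reading R2 it is attainment in chart coordinates (FINDING #3), displayed honestly below as `stub_existenceMinimalOrbit`.
Content: the contraction (116)–(121) pp.294–296 ([Balaban1985BackgroundPropagators] Thm 3.13 inverse bounds) and «L-critical in the ball ⇒ solves (111)».
Why it might fail: the typed `CritLPrint` (reading R2) is stronger than (111), so uniqueness as typed is WEAKER than print's — low risk; the risk is in the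
letters (`nMax19` ball vs print's (19) norms). [cite: Balaban1985Variational, Prop. 6 p.295, (111)-(121) pp.294-296, (122) p.296; Balaban1985BackgroundPropagators, Thm 3.13 p.401] -/
theorem stub_PV3Cuniq : ∀ (L : ℕ), 1 < L → ∀ (B₃ : ℝ), 4 < B₃ →
    ∃ B₀ a₄ : ℝ, 0 < B₀ ∧ 0 < a₄ ∧ ∀ (i : Idx L) (ε₁ ε₄ : ℝ), 0 < ε₁ → ε₄ ≤ a₄ → 2 * B₀ * (L : ℝ) ^ 3 * B₃ * ε₁ ≤ ε₄ →
      ∀ (V : GaugeField (i.1.1.P i.1.2.1) 0 (Matrix.specialUnitaryGroup (Fin 2) ℂ)) (U₀ : GaugeField (i.1.1.P i.1.2.2) 0 (Matrix.specialUnitaryGroup (Fin 2) ℂ)),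
        RegPr i.1.1 i.1.2.1 i.1.2.2 ((L : ℝ) ^ 3 * B₃ * ε₁) U₀ → CloseAvg i.1.1 i.1.2.1 i.1.2.2 i.2.2.le ((L : ℝ) ^ 3 * ε₁) V U₀ →
        ∀ X X' : PBond (i.1.1.P i.1.2.2) 0 → Matrix (Fin 2) (Fin 2) ℂ,
          nMax19 i.1.1 i.1.2.1 i.1.2.2 U₀ X < ε₄ →
          ((∀ b : PBond (i.1.1.P i.1.2.2) 0, (X b).IsHermitian ∧ Matrix.trace (X b) = 0) ∧ AvgCondPrint i.1.1 i.1.2.1 i.1.2.2 i.2.2.le V U₀ X ∧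
            IsLandauPrint i.1.1 i.1.2.1 i.1.2.2 U₀ X ∧ CritLPrint i.1.1 i.1.2.1 i.1.2.2 i.2.2.le V U₀ (expHermField X)) →
          nMax19 i.1.1 i.1.2.1 i.1.2.2 U₀ X' < ε₄ →
          ((∀ b : PBond (i.1.1.P i.1.2.2) 0, (X' b).IsHermitian ∧ Matrix.trace (X' b) = 0) ∧ AvgCondPrint i.1.1 i.1.2.1 i.1.2.2 i.2.2.le V U₀ X' ∧
            IsLandauPrint i.1.1 i.1.2.1 i.1.2.2 U₀ X' ∧ CritLPrint i.1.1 i.1.2.1 i.1.2.2 i.2.2.le V U₀ (expHermField X')) → X = X' := by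
  sorry

-- (row D LANDED p589019 `…Theorems.PV3D.stub_PV3D`; row E′ documentary — RULING g24-№3′: both leave the skeleton)


/-- ROW (EX) — THE EXISTENCE CLAUSE OF PROP. 7 FROM A BACKGROUND (14), uniformly, reading R1 (text SHARED VERBATIM with line «route-R»'s
`RouteR.stub_existenceMinimalOrbit`, p1 g10 pen 3f491a7acec57804 — one landing credits both lines): for every `L > 1`, `B₃ > 4` SOME `a′₁ > 0`, `O₁ ≥ 1` such that
for every member, `0 < ε₁ ≤ a′₁`, every (7)-datum `V` and every background `U₀ ∈ 𝔘_k(L³B₃ε₁) ∩ 𝔅_k(V)` there is a MINIMISER of the Wilson action over print's regular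
fibre `(6)(O₁L³B₃ε₁)`.  DISPLAYED AS ITSELF, honestly: print's internal route (Props 5–6 ∃ a solution of (111) → (141)–(142) local minimality → [B8] Thm 2 covering,
p.299) passes through E–L-criticality, which the carrier does not type (its `IsCritR2` = minimiser over SOME regular fibre makes every «∃ critical» statement an
attainment statement — w2-19200 FINDING #3); attack routes recorded in the card: (α) print's chart route after an `IsCritEL` notion, (β) direct method on the CLOSED
fibre + KKT-halving interiority (unprinted).  Why it might fail: as typed it is implied by [Balaban1985Variational] Thm 1 (8) + Prop. 8, i.e. by print; the risk is
only in reading R1 vs print's «minimal orbit» (orbit-closure of an R1 minimiser is R1). [cite: Balaban1985Variational, Prop. 7 p.299, (14) p.280, (141)-(142) p.299, Thm 1 (8) p.279] -/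
theorem stub_existenceMinimalOrbit : ∀ (L : ℕ), 1 < L → ∀ (B₃ : ℝ), 4 < B₃ → ∃ a₁' O₁ : ℝ, 0 < a₁' ∧ 1 ≤ O₁ ∧
    ∀ (F : T3Family), F.L = L → ∀ (n K : ℕ) (hnK : n < K) (ε₁ : ℝ), 0 < ε₁ →
      ∀ V : GaugeField (F.P n) 0 (Matrix.specialUnitaryGroup (Fin 2) ℂ), PlaqSmall ε₁ V →
        ∀ U₀ : GaugeField (F.P K) 0 (Matrix.specialUnitaryGroup (Fin 2) ℂ), RegPr F n K ((L : ℝ) ^ 3 * B₃ * ε₁) U₀ → U₀ ∈ fibre F ℰp n K hnK.le V →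
          ε₁ ≤ a₁' → ∃ U ∈ regFibrePr F n K hnK.le (O₁ * (L : ℝ) ^ 3 * B₃ * ε₁) V,
            IsMinOn (fun W : GaugeField (F.P K) 0 (Matrix.specialUnitaryGroup (Fin 2) ℂ) => wilsonAction4 W)
              (regFibrePr F n K hnK.le (O₁ * (L : ℝ) ^ 3 * B₃ * ε₁) V) U := by
  sorry

/-- LANDED V2 (the v6 text of `stub_prop8`, now a theorem modulo V2′) — [Balaban1985Variational] PROPOSITION 8 at the d = 3 carriers for the SAME B₃ > 4, by the
kernel-checked halving iteration: p1 g14's `Summit.QuantumFields.YangMills.Theorems.Prop8Iter.prop8_of_halvingLiteral` over lit-balaban's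
`B11Prop8Assembly.prop8Printed_of_halvingStep` («We continue this way until we reach the bound B₃ε₁»). [cite: Balaban1985Variational, Prop. 8 p.304] -/
theorem landed_prop8 : ∀ (L : ℕ), 1 < L → ∃ B₃ : ℝ, 4 < B₃ ∧ Prop8Printed B₃ (famX L) :=
  Summit.QuantumFields.YangMills.Theorems.Prop8Iter.prop8_of_halvingLiteral stub_halvingStep

/-- **V3 (v7 text VERBATIM) from rows A ∧ C-uniq ∧ EX** — no sorry of its own: clause (i) by `Prop7PV3CUniqueness.atMostOneCriticalOrbit_of_A_Cuniq` at the based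
presentation `sPrint L T₀` (any Sect. C–E tail `T₀`: every field is overwritten), bridged to the V3 binders by `sat14T3_of_mem_fibre`; clause (ii) = EX at the radius
`O₁L³B₃ε₁` (reading R1, anonymous-constructor defeq with `OnMinimalOrbit`). [cite: Balaban1985Variational, Prop. 7 p.299, (122) p.296, (14) p.280] -/
theorem prop7From14_v9 : ∀ (L : ℕ), 1 < L → ∀ B₃ : ℝ, 4 < B₃ →
    ∃ a₀ a₁' O₁ : ℝ, 0 < a₀ ∧ 0 < a₁' ∧ 1 ≤ O₁ ∧ ∀ (i : Idx L) (ε₀ ε₁ : ℝ), 0 < ε₁ → ∀ V : (famX L i).Bdry, (famX L i).Reg7 ε₁ V →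
      ∀ U₀ : (famX L i).Cfg, (famX L i).InU ((L : ℝ) ^ 3 * B₃ * ε₁) U₀ → (famX L i).InB V U₀ →
        (ε₀ ≤ a₀ → B₃ * ε₁ ≤ ε₀ → (famX L i).AtMostOneCriticalOrbit ε₀ V) ∧
        (ε₁ ≤ a₁' → ∃ U : (famX L i).Cfg, (famX L i).OnMinimalOrbit (O₁ * (L : ℝ) ^ 3 * B₃ * ε₁) V U) := by
  intro L hL B₃ hB₃
  -- a Sect. C–E tail: every field is overwritten by `sPrint` (Sect. A–B letters), so any tail gives print's presentation (as in v8)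
  let T₀ : ResidFam L := fun i =>
    { IsAxial := fun _ _ => True, Restricted := fun _ _ => True, AvgCond := fun _ _ _ => True, IsLandau := fun _ _ => True,
      CritL := fun _ _ _ => True, In43 := fun _ _ _ => True, nM1 := fun _ _ => 0, Def47 := fun _ _ => True, T47 := fun _ X => X,
      normD := fun _ _ => 0, kerD := fun _ _ _ _ => 0, nMax := fun _ _ => 0, dVn := fun _ _ => 0, dVAnalytic := fun _ _ => True,
      Sol111 := fun _ _ _ => True, T112 := fun _ U₀ _ => U₀, LikeH1B := fun _ _ _ => True, Sol111G := fun _ _ _ => True,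
      SolAnalytic := fun _ _ _ => True }
  have hB₃1 : (1 : ℝ) ≤ B₃ := by linarith
  have hL1 : (1 : ℝ) ≤ (L : ℝ) := by exact_mod_cast hL.le
  have hC₁pos : (0 : ℝ) < (L : ℝ) ^ 3 := by positivity
  -- clause (i) from rows (A) and (C-uniq): [Balaban1985Variational] (122) p.296 with Thm 2 representatives
  obtain ⟨B₁, c₁, hB₁, hc₁, h2⟩ := stub_PV3A L hL T₀ B₃ hB₃
  have hA' : ∃ B₁ c₁ : ℝ, 0 < B₁ ∧ 0 < c₁ ∧ Prop2Printed B₁ B₃ ((L : ℝ) ^ 3) c₁ (famLG3 L (tPrintFam (sPrint L T₀))) :=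
    ⟨B₁, c₁, hB₁, hc₁, (Summit.QuantumFields.YangMills.Theorems.Prop7PV3CDEAtSPrint.prop2Printed_tPrintFam_iff (sPrint L T₀)).2 h2⟩
  obtain ⟨a₀, ha₀, HU⟩ := Summit.QuantumFields.YangMills.Theorems.Prop7PV3CUniqueness.atMostOneCriticalOrbit_of_A_Cuniq hL (sPrint L T₀) hB₃1
    (hSax_sPrint T₀) (hSre_sPrint T₀) hA' (stub_PV3Cuniq L hL B₃ hB₃)
  -- clause (ii) = row (EX) verbatim (reading R1)
  obtain ⟨a₁', O₁, ha₁', hO₁, hE⟩ := stub_existenceMinimalOrbit L hL B₃ hB₃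
  refine ⟨a₀, a₁', O₁, ha₀, ha₁', hO₁, ?_⟩
  intro i ε₀ ε₁ hε₁ V hV U₀ hU₀ hB
  have h14 : (famLG3 L (tPrintFam (sPrint L T₀)) i).Sat14 ((L : ℝ) ^ 3 * B₃ * ε₁) ((L : ℝ) ^ 3 * ε₁)
      ((bridgeFam3 L (tPrintFam (sPrint L T₀)) i).bdry V) U₀ := by
    obtain ⟨⟨F, n, K⟩, hF, hnK⟩ := i
    exact sat14T3_of_mem_fibre (mul_pos hC₁pos hε₁) hU₀ hB
  refine ⟨fun hε₀a hB₃ε => HU i ε₀ ε₁ hε₁ hε₀a hB₃ε V U₀ h14, fun hε₁a => ?_⟩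
  obtain ⟨⟨F, n, K⟩, hF, hnK⟩ := i
  obtain ⟨U, hU, hmin⟩ := hE F hF n K hnK ε₁ hε₁ V hV U₀ hU₀ hB hε₁a
  exact ⟨U, hU, hmin⟩

/-- LANDED V4′ — the log-Lipschitz curvature gradient of critical configurations in (8), p1 g13's
`Summit.QuantumFields.YangMills.Theorems.CritCurvGradLog.stub_critCurvGradLog` (p511133; proved for EVERY (8)-regular configuration, `regPr_curvGrad_lt`;
cell memo HOME/UV3-NODE.md §22). [cite: Balaban1985Variational, Thm 1 (9) p.279; Balaban1985RegularSpaces, Thm 2 p.83, (1.36) p.82] -/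
theorem stub_critCurvGradLog : ∀ (L : ℕ), 1 < L → ∀ B₃ : ℝ, 4 < B₃ → ∃ a₁ B₄ : ℝ, 0 < a₁ ∧ 0 < B₄ ∧ CritCurvGradLogAt L a₁ B₃ B₄ :=
  Summit.QuantumFields.YangMills.Theorems.CritCurvGradLog.stub_critCurvGradLog

/-! ## §2 Landed inputs, by name -/

/-- LANDED — located gap G-K1a-2′ (smooth exact one-step lift), v4's `stub_smoothLift`, p466834. [cite: King1986, (A.5) p.676] -/
theorem landed_smoothLift : ∀ (L : ℕ), ∃ C₁ C₂ c : ℝ, 0 < C₁ ∧ 0 ≤ C₂ ∧ 0 < c ∧ SmoothLiftAt L C₁ C₂ c :=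
  Summit.QuantumFields.YangMills.Theorems.SmoothLift.stub_smoothLift

/-- LANDED — located gap G-K1a-3a′ (first-order regularity of the one-step average), p440643. [cite: Balaban1985Averaging, Prop. 3 (122)-(123) p.36] -/
theorem landed_avgCurvGrad : ∀ (L : ℕ), ∃ C₁ C₂ c : ℝ, 0 ≤ C₁ ∧ 0 < C₂ ∧ 0 < c ∧ AvgCurvGradAt L C₁ C₂ c :=
  Summit.QuantumFields.YangMills.Theorems.AvgCurvGrad.stub_avgCurvGrad

/-- LANDED — located gap G-K1a-3b′ (per-configuration averaging action defect), p437535. [cite: Federbush1987PhaseCellIII, Thm 4.3 (4.5) p.299] -/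
theorem landed_avgActionDefect : ∀ (L : ℕ), ∃ C₂ c : ℝ, 0 ≤ C₂ ∧ 0 < c ∧ AvgActionDefectAt L C₂ c :=
  Summit.QuantumFields.YangMills.Theorems.AvgActionDefect.stub_avgActionDefect

/-- **THE VARIATIONAL DATA FROM THE THREE LEAVES** (no sorry of its own): attainment over (6) from V3 ∧ V2 (p478378 `minSixAttainedAt_of_prop7_prop8`),
`MinimisersIn8At` from V2 (p428575 `minimisersIn8At_of_prop8`), and the log-Lipschitz minimiser schema from V4′ ∧ V2 (`minimiserCurvGradLogAt_of_crit`).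
[cite: Balaban1985Variational, Thm 1 p.279, Prop 7 p.299, Prop 8 p.304] -/
theorem variational_of_leaves_log (L : ℕ) (hL : 1 < L) :
    ∃ â₀ â₁ a₀ a₁ B₃ B₄ : ℝ, 0 < â₀ ∧ 0 < â₁ ∧ 0 < a₀ ∧ 0 < a₁ ∧ 0 < B₃ ∧ 0 < B₄ ∧
      MinSixAttainedAt L â₀ â₁ B₃ ∧ MinimisersIn8At L a₀ a₁ B₃ ∧ MinimiserCurvGradLogAt L a₀ a₁ B₃ B₄ := by
  obtain ⟨B₃, hB₃, h8⟩ := landed_prop8 L hL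
  have h7 := prop7From14_v9 L hL B₃ hB₃
  obtain ⟨a₁, B₄, ha₁, hB₄, hc⟩ := stub_critCurvGradLog L hL B₃ hB₃
  have hB₃0 : 0 < B₃ := by linarith
  obtain ⟨â₀, â₁, hâ₀, hâ₁, hatt⟩ := Summit.QuantumFields.YangMills.Theorems.Variational.minSixAttainedAt_of_prop7_prop8 hL hB₃ h7 h8
  obtain ⟨a₅, ha₅, h8'⟩ := minimisersIn8At_of_prop8 hB₃0 h8
  exact ⟨â₀, â₁, a₅, a₁, B₃, B₄, hâ₀, hâ₁, ha₅, ha₁, hB₃0, hB₄, hatt, h8' a₁, minimiserCurvGradLogAt_of_crit hB₃0 hc (h8' a₁)⟩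

/-! ## §3 The composition — concludes the ROUTE DECL by name, no sorry of its own -/

/-- **`MinimiserStabilityRegPr ⇐ (stub_halvingStep ∧ stub_PV3A ∧ stub_PV3Cuniq ∧ stub_existenceMinimalOrbit) ∧ landed V4′ `stub_critCurvGradLog` ∧ landed_prop8 (iteration) ∧ landed_smoothLift ∧ landed_avgCurvGrad ∧ landed_avgActionDefect`**:
EXIST by `T3ExistSplit.hasRegMinimisersPrAt_of_attained`, UPPER by `T3UpperLiftSplitLog.upperAlongRegPrMinimisersAt_of_splitLog'`, LOWER by
`T3SplitLog.lowerAlongRegPrMinimisersAt_of_splitLog'''` (both through the log-Lipschitz schema with K-dependent windows), then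
`minimiserStabilityRegPrAt_of_alongRegPrMinimisers`; ε₁ := min of three, m₀ := 10, γ₁ := min of three; `p₀ > 2 > 0`; `L ≤ 1` is vacuous. -/
theorem MinimiserStabilityRegPr_of : Summit.QuantumFields.YangMills.Theses.UnitScaleTilt.MinimiserStabilityRegPr := by
  intro L
  by_cases hL : 1 < L
  · obtain ⟨â₀, â₁, a₀, a₁, B₃, B₄, hâ₀, hâ₁, ha₀, ha₁, hB₃, hB₄, hatt, hIn8, hgrad⟩ := variational_of_leaves_log L hL
    -- EXIST
    obtain ⟨e₁, he₁, hE⟩ := hasRegMinimisersPrAt_of_attained hâ₀ hâ₁ hB₃ hatt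
    -- UPPER
    obtain ⟨C₁, C₂, c, hC₁, hC₂, hc, hlift⟩ := landed_smoothLift L
    obtain ⟨e₂, he₂, hU⟩ := upperAlongRegPrMinimisersAt_of_splitLog' ha₀ ha₁ hB₃ hB₄ hC₁ hC₂ hc hIn8 hgrad hlift
    -- LOWER
    obtain ⟨D₁, D₂, d, hD₁, hD₂, hd, havg⟩ := landed_avgCurvGrad L
    obtain ⟨E₂, e, hE₂, he, hdef⟩ := landed_avgActionDefect L
    obtain ⟨e₃, he₃, hLo⟩ := lowerAlongRegPrMinimisersAt_of_splitLog''' hL.le ha₀ ha₁ hB₃ hB₄ hD₂ hd hE₂ he hIn8 hgrad havg hdef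
    -- the common `ε₁`, `m₀ = 10`, `γ₁`
    refine ⟨min e₁ (min e₂ e₃), lt_min he₁ (lt_min he₂ he₃), fun ε₀ hε hεle => ⟨10, fun m hm b₀ p₀ hb hp => ?_⟩⟩
    have hε₁ : ε₀ ≤ e₁ := hεle.trans (min_le_left _ _)
    have hε₂ : ε₀ ≤ e₂ := hεle.trans ((min_le_right _ _).trans (min_le_left _ _))
    have hε₃ : ε₀ ≤ e₃ := hεle.trans ((min_le_right _ _).trans (min_le_right _ _))
    have hm2 : 2 ≤ m := le_trans (by norm_num) hm
    have hp0 : 0 < p₀ := lt_trans two_pos hp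
    obtain ⟨γa, hγa, hA⟩ := hE ε₀ hε hε₁ m hm2 b₀ p₀ hb
    obtain ⟨γb, hγb, hB⟩ := hU ε₀ hε hε₂ m hm b₀ p₀ hb hp0
    obtain ⟨γc, hγc, hC⟩ := hLo ε₀ hε hε₃ m hm b₀ p₀ hb hp0
    refine ⟨min γa (min γb γc), lt_min hγa (lt_min hγb hγc), fun F γ hFL hγ hγle => ?_⟩
    have hγa' : γ ≤ γa := hγle.trans (min_le_left _ _)
    have hγb' : γ ≤ γb := hγle.trans ((min_le_right _ _).trans (min_le_left _ _))
    have hγc' : γ ≤ γc := hγle.trans ((min_le_right _ _).trans (min_le_right _ _))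
    exact minimiserStabilityRegPrAt_of_alongRegPrMinimisers hγ.le (hA F γ hFL hγ hγa') (hB F γ hFL hγ hγb') (hC F γ hFL hγ hγc')
  · -- no member of the family has block size `L ≤ 1`
    exact ⟨1, one_pos, fun ε₀ _ _ => ⟨0, fun m _ b₀ p₀ _ _ => ⟨1, one_pos, fun F γ hFL _ _ => absurd (hFL ▸ F.hL.2) hL⟩⟩⟩

end Summit.QuantumFields.YangMills.Cruxes.MinimiserStabilityRegPr.BirthV9

end
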